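import Summits.BirchSwinnertonDyer.BirchSwinnertonDyer.Theorems.ByReductionTypeAtTwoAdditivePotGoodKatoHalf
import HarnessLib

/-!
# Crux `AdditiveRankZeroAtTwo` (K4 item 19098), the QUADRATIC potentially-good sub-class (`Φ(E,2) = C₂`, 100 census
# classes): lane A's over-`K` stub is needed there only as a LOWER half — seat `bsd-2adic-addL2x` GEN 11

Cell `bsd-2adic`, rung K4, crux stmt-BirchSwinnertonDyer-19098, line add_twist_overK v2. `--supports 19098 --as helper`.
HONEST FRAMING (D-0036/D-0054): conditional theorems; every research-grade input displayed; closes nothing at the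
`∀`-level; nothing booked; BSD is not proved by any of this.

WHAT THIS FILE DOES. `…AdditivePotGoodKatoHalf.lean` (this GEN, p627985) types the KATO HALF `MissingUpperBoundAt W 2` on
the whole additive potentially-good class. On its quadratically semistabilisable part (`Φ = C₂`: additive at `2`,
`0 ≤ ord₂ j`, a quadratic twist good at `2`) the line's stub `stub_addQuadraticOverK` (lane A) asks for the FULL `2`-part
of BSD over an admissible quadratic field `K` (`MissingPPartOverCAt (W.baseChange K) 2`). Granted the Kato half, only
its LOWER half `MissingLowerBoundOverCAt (W.baseChange K) 2` («`ord₂ #Ш_an(E/K) ≤ ord₂ #Ш(E/K)`», the main-conjecture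
direction — the shape lane A's `Λ_{K*}`-IMC road supplies) is needed:

* §1 `addTwist_lower_of_lowerOverKC` — ONE-SIDED Milne descent on the canonical model: the lower half over `K` and
  `BSD(Wd, p)` for a minimal model `Wd` of the twist give the lower half over `ℚ` (the tree's
  `AdditivePotMult.missingLowerBoundAt_iff_overC` with Milne any-model `hMilneC` and GZK finiteness); any `p`.
  `good_of_semistableTwist_of_padicValRat_j_nonneg` — the semistable twist of a potentially GOOD curve is good at `2`
  (multiplicative would force `ord₂ j < 0`, `EisensteinPrimes.padicValRat_j_neg_of_mult`), so only the GOOD siblings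
  `GoodOrdinaryRankZeroAtTwo` / `SupersingularRankZeroAtTwo` are met on this sub-class.
* §2 `addQuadPotGood_bsdp_two_of_kato_of_lowerOverKC` — BSD₂ on the `C₂` sub-class from the Kato half (§2 of the
  predecessor: PRINT + READINGS + (I1″) `hAna` + (I2″) `hRest`), the two GOOD sibling cruxes, Hoffstein–Luo twist supply,
  Milne any-model, and lane A's over-`K` stub weakened to its LOWER half on `0 ≤ ord₂ j` (`hQKlow`).

References: [Milne1972ArithmeticAV] §1 Thm. 1 (through [DokchitserDokchitserAnnals2010] §2.1); [HoffsteinLuo1997];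
[Kato2004Asterisque] Thm. 12.5, §14.14, Prop. 14.16 (2); [CoatesSujatha2005] statement (A); [SilvermanAEC2009] VII.5.1;
[Miller2011LMS] Def. 1.1.
-/

set_option autoImplicit false
set_option linter.dupNamespace false

noncomputable section

open scoped Classical

namespace Summit.BirchSwinnertonDyer.BirchSwinnertonDyer.Theorems.AddKatoTwo

open WeierstrassCurve Literature.NumberTheory.EllipticCurves
  Literature.NumberTheory.EllipticCurves.ModularForms
  Literature.NumberTheory.EllipticCurves.Kato2004
  Literature.NumberTheory.EllipticCurves.Rank1Residual
  Literature.NumberTheory.EllipticCurves.Rank1Residual.Typed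
  Literature.NumberTheory.IwasawaTheory
  Summit.BirchSwinnertonDyer.Rank1Residual Summit.BirchSwinnertonDyer.Rank1Residual.AdditivePotMult
  Summit.BirchSwinnertonDyer.Rank1Residual.X5.AddTwoL2
  Summit.BirchSwinnertonDyer.BirchSwinnertonDyer.Theses.ByReductionTypeAtTwo

/-! ## §1 One-sided Milne descent; the semistable twist of a potentially good curve is good -/

/-- **ONE-SIDED descent on the canonical model, lower half** (any prime `p`): for `W/ℚ` globally minimal of analytic rank
`≤ 1`, `K` quadratic, `Wd` a globally minimal model of `W^{(d_K)}` of analytic rank `≤ 1` with `BSD(Wd, p)`: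
`MissingLowerBoundOverCAt (W.baseChange K) p → MissingLowerBoundAt W p`. Milne's any-model Weil-restriction identity and
the finiteness of `Ш(E_K)` come from the named fact `hMilneC`, finiteness over `ℚ` from GZK; the comparison is the tree's
`AdditivePotMult.missingLowerBoundAt_iff_overC`. [cite: Milne1972ArithmeticAV, §1 Thm. 1 (through DokchitserDokchitserAnnals2010 §2.1)] -/
theorem addTwist_lower_of_lowerOverKC (W : WeierstrassCurve ℚ) [W.IsElliptic] [W.IsGloballyMinimal]
    (p : ℕ) [Fact p.Prime] (K : Type) [Field K] [NumberField K]
    (Wd : WeierstrassCurve ℚ) [Wd.IsElliptic] [Wd.IsGloballyMinimal]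
    (hGZK : rank_eq_analyticRank_of_analyticRank_le_one) (hmod : hasEntireLFunction_rat)
    (hMilneC : Milne1972.bsdQuotient_baseChange_quadratic_anyModel)
    (hr : W.analyticRank ≤ 1) (h2 : Module.finrank ℚ K = 2)
    (hWd : ∃ C : VariableChange ℚ, C • W.quadraticTwist (NumberField.discr K : ℚ) = Wd)
    (hrd : Wd.analyticRank ≤ 1) (hK : MissingLowerBoundOverCAt (W.baseChange K) p) (hd : BSDp Wd p) :
    MissingLowerBoundAt W p := by
  haveI : (W.baseChange K).IsElliptic := by rw [baseChange]; infer_instance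
  have hV : ∃ C : VariableChange K, C • W.baseChange K = W.baseChange K := ⟨1, one_smul _ _⟩
  obtain ⟨-, hfinW⟩ := hGZK W hr
  obtain ⟨-, hfinD⟩ := hGZK Wd hrd
  obtain ⟨hshaK, hWR⟩ := hMilneC W K h2 Wd hWd (W.baseChange K) hV hfinW hfinD
  exact (missingLowerBoundAt_iff_overC W p K Wd (W.baseChange K) hmod h2 hWd hV hfinW hfinD hshaK hWR hd).mpr hK

/-- **The semistable twist of a potentially GOOD additive curve is GOOD at `2`**: if `0 ≤ ord₂ j(W)` and `Wd` is a model
of `W^{(d)}` (`d ≠ 0`) which is good-ordinary, good-supersingular or multiplicative at `2`, then it is good-ordinary or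
good-supersingular — multiplicative reduction would force `ord₂ j(Wd) = ord₂ j(W) < 0`
(`EisensteinPrimes.padicValRat_j_neg_of_mult`). [cite: SilvermanAEC2009, Prop. VII.5.1 (b)] -/
theorem good_of_semistableTwist_of_padicValRat_j_nonneg (W : WeierstrassCurve ℚ) [W.IsElliptic]
    (hj : 0 ≤ padicValRat 2 W.j) {d : ℚ} (hd : d ≠ 0)
    (Wd : WeierstrassCurve ℚ) [Wd.IsElliptic] [Wd.IsGloballyMinimal]
    (hWd : ∃ C : VariableChange ℚ, C • W.quadraticTwist d = Wd)
    (hred : GoodOrd Wd 2 ∨ GoodSS Wd 2 ∨ Mult Wd 2) : GoodOrd Wd 2 ∨ GoodSS Wd 2 := by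
  haveI : Fact (Nat.Prime 2) := ⟨Nat.prime_two⟩
  rcases hred with hgo | hss | hm
  · exact Or.inl hgo
  · exact Or.inr hss
  · exfalso
    obtain ⟨C, rfl⟩ := hWd
    haveI := W.isElliptic_quadraticTwist hd
    have hjWd : (C • W.quadraticTwist d).j = W.j := by
      rw [(W.quadraticTwist d).variableChange_j C, W.j_quadraticTwist hd]
    have hneg := EisensteinPrimes.padicValRat_j_neg_of_mult (C • W.quadraticTwist d) 2 hm
    rw [hjWd] at hneg
    exact absurd hj (not_le.mpr hneg)

/-! ## §2 The C₂ sub-class: lane A's over-`K` stub ONE-SIDED given the Kato half -/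

/-- **BSD₂ on the quadratic potentially-good sub-class (`Φ(E,2) = C₂`) from the Kato half and the LOWER half over `K`.**
For every non-CM globally minimal `W` of analytic rank `0`, additive at `2` with `0 ≤ ord₂ j` and quadratically
semistabilisable: GRANTED — PRINT {`hGZK`, `hmod`, `hmodN`, `hMilneC`, `hHL`, `hLim2`, `hFW`, `hCassels`, `hCT`} + READINGS
{`hSharp`, `hin`} + the GOOD sibling cruxes `hOrd` (19095) and `hSS` (19097) by name + (I1″) `hAna` + (I2″) `hRest` (the
Kato-half residuals of `addPotGoodUpper_two_of_conjA_of_rest`) + **`hQKlow`** = lane A's stub `stub_addQuadraticOverK`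
WEAKENED to its lower half `MissingLowerBoundOverCAt (W.baseChange K) 2` on `0 ≤ ord₂ j` — `BSD₂(W)`. Proof: Hoffstein–Luo
(`existsSemistabilisingNonvanishingTwist_of_hoffsteinLuo`) supplies `K` with `W^{(d_K)}` semistable at `2` and
`L(W^{(d_K)},1) ≠ 0`; its minimal model `Wd` is non-CM, `r_an = 0` and GOOD at `2` (§1), so `hOrd`/`hSS` give `BSD₂(Wd)`;
§1 descends `hQKlow` to the lower half over `ℚ`; the Kato half is the predecessor's; `missingPPartAt_of_lower_of_upper` +
`bsdp_of_missingPPartAt`. Conditional; closes nothing. [cite: Milne1972ArithmeticAV, §1 Thm. 1] [cite: HoffsteinLuo1997, Theorem]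
[cite: Kato2004Asterisque, Thm. 12.5 (1)(3), Prop. 14.16 (2)] [cite: CoatesSujatha2005, statement (A)] [cite: Miller2011LMS, §1 and Def. 1.1] -/
theorem addQuadPotGood_bsdp_two_of_kato_of_lowerOverKC
    (hGZK : rank_eq_analyticRank_of_analyticRank_le_one) (hmod : hasEntireLFunction_rat) (hmodN : exists_isNewformOf)
    (hMilneC : Milne1972.bsdQuotient_baseChange_quadratic_anyModel)
    (hHL : HoffsteinLuo1997_exists_twist_L_one_ne_zero)
    (hLim2 : Lim2017.thm35_at_two_fineSelmerDual_moduleFinite_of_classicalMuVanishes_of_le_divisionField_four)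
    (hFW : ferreroWashington1979_classicalMuVanishes)
    (hCassels : bsdRHS_eq_of_isIsogenous) (hCT : exists_casselsTate_pairing (K := ℚ))
    (hSharp : Kato2004.rankZero_padicValNat_sha_add_padicValNat_tamagawa_le_at_two_of_irreducible_of_fineSelmerDual_fg)
    (hin : Kato2004.exists_memberHullInputs_two)
    (hOrd : GoodOrdinaryRankZeroAtTwo) (hSS : SupersingularRankZeroAtTwo)
    (hAna : ∀ (W : WeierstrassCurve ℚ) [W.IsElliptic] [W.IsGloballyMinimal], ¬ W.HasCM → W.analyticRank = 0 →
      Addv W 2 → 0 ≤ padicValRat 2 W.j → ¬ IsAbelianGalois ℚ (W.divisionField 2) →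
      ∀ (κ : ZpExtension ℚ 2), κ.IsCyclotomic →
        ∃ (γ : Field.absoluteGaloisGroup ℚ) (D : W.FineSelmerDualData κ γ),
          Module.Finite ℤ_[2] (RestrictScalars ℤ_[2] (IwasawaAlgebra 2) D.X))
    (hRest : ∀ (W : WeierstrassCurve ℚ) [W.IsElliptic] [W.IsGloballyMinimal], ¬ W.HasCM → W.analyticRank = 0 →
      Addv W 2 → 0 ≤ padicValRat 2 W.j → ¬ W.HasIrreducibleModPGaloisRep 2 →
      ¬ ((∀ (W' : WeierstrassCurve ℚ) [W'.IsElliptic], IsIsogenous W W' → ¬ 2 ^ 2 ∣ W'.torsionOrder) ∧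
          (∀ q : ℚ, shaAn W = (q : ℂ) → Even (padicValRat 2 q))) →
      MissingUpperBoundAt W 2)
    (hQKlow : ∀ (W : WeierstrassCurve ℚ) [W.IsElliptic] [W.IsGloballyMinimal], ¬ W.HasCM → W.analyticRank = 0 →
      Addv W 2 → 0 ≤ padicValRat 2 W.j → ∀ (K : Type) [Field K] [NumberField K], Module.finrank ℚ K = 2 →
        SemistableTwistAtTwo W K → (W.quadraticTwist (NumberField.discr K : ℚ)).entireLFunction 1 ≠ 0 →
          MissingLowerBoundOverCAt (W.baseChange K) 2) :
    ∀ (W : WeierstrassCurve ℚ) [W.IsElliptic] [W.IsGloballyMinimal], ¬ W.HasCM → W.analyticRank = 0 →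
      Addv W 2 → 0 ≤ padicValRat 2 W.j → QuadSemistabilisable W → BSDp W 2 := by
  intro W _ _ hcm hr hadd hj hq
  haveI : Fact (Nat.Prime 2) := ⟨Nat.prime_two⟩
  obtain ⟨K, _, _, h2, hst, hL⟩ := Theorems.existsSemistabilisingNonvanishingTwist_of_hoffsteinLuo hHL W hq
  obtain ⟨Wd, _, _, hWd, hcmd, hrd, hred⟩ := Theorems.exists_minimalTwist_semistable_rankZero W hcm K hst hL
  have hdK : (NumberField.discr K : ℚ) ≠ 0 := by exact_mod_cast NumberField.discr_ne_zero K
  have hd : BSDp Wd 2 := by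
    rcases good_of_semistableTwist_of_padicValRat_j_nonneg W hj hdK Wd hWd hred with hgo | hss
    · exact hOrd Wd hcmd hrd hgo
    · exact hSS Wd hcmd hrd hss
  have hr1 : W.analyticRank ≤ 1 := by rw [hr]; exact zero_le_one
  have hrd1 : Wd.analyticRank ≤ 1 := by rw [hrd]; exact zero_le_one
  have hlow : MissingLowerBoundAt W 2 :=
    addTwist_lower_of_lowerOverKC W 2 K Wd hGZK hmod hMilneC hr1 h2 hWd hrd1 (hQKlow W hcm hr hadd hj K h2 hst hL) hd
  exact bsdp_of_missingPPartAt W 2 hGZK hr1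
    (missingPPartAt_of_lower_of_upper W 2 hlow
      (addPotGoodUpper_two_of_conjA_of_rest hGZK hmod hmodN hLim2 hFW hCassels hCT hSharp hin hAna hRest W hcm hr hadd hj))

end Summit.BirchSwinnertonDyer.BirchSwinnertonDyer.Theorems.AddKatoTwo

end
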